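import Literature.AlgebraicGeometry.HodgeTheory.GAGALocalEquation
import Literature.AlgebraicGeometry.HodgeTheory.GAGAZeroDivisorSupport
import Literature.AlgebraicGeometry.Motives.CurvePointDivisor
import Literature.AlgebraicGeometry.Motives.CurveRiemannRoch
import Literature.AlgebraicGeometry.Motives.CartierDivisorClassPullback
import Literature.AlgebraicGeometry.Motives.CurveGeneralDivisorsNonempty
import Literature.Geometry.Kaehler.CurveResidueTheorem
import Mathlib.Analysis.Analytic.Order
import HarnessLib

/-!
# Pole spaces `L(N·P)^an` on the analytification of a smooth projective complex curve

Family `hodge`, layer `Literature/AlgebraicGeometry/HodgeTheory`. Let `C/ℂ` be a smooth projective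
curve (integral, smooth of relative dimension one, proper), `φ : M → C(ℂ)` an analytification
(`IsAnalytification E C 1 φ`, holomorphic atlas on `M`), `ℓ : E ≃ ℂ` a linear coordinate, `p ∈ M`
and `P = φ p`. This file PROVES (theorems only; no definitions, no named facts — D-0026) the
algebraic input of the bound `dim H^{1,0}(C) ≤ g(C)`
(`Geometry/Kaehler/CurveOneFormsBound.finrank_le_of_forall_exists_poleSpace`, hypotheses `hV`):

* `exists_poleSpace` — for every `N` the analytifications `m ↦ f(φ m)` of the sections
  `f ∈ Γ(C, 𝒪_C(N·[P])) ⊆ K(C)` (the tree's `CartierDivisor.sections` of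
  `N • CurvePlaces.pointDivisor`) form a `ℂ`-space `V_N` of functions on `M`, each holomorphic off
  `p` (J.-P. Serre, GAGA §2 n°6: regular functions are holomorphic,
  `IsAnalytification.mdifferentiableOn_evalOrZero_opens_holds`), each with a pole of order `≤ N` at
  `p` in the chart at `p` (`h = (z − c)^{−N} G`, `G` holomorphic at `c = ℓ(chart p)`), each
  determined by its values off `p`, and `dim V_N ≥ N + 1 − g` — Riemann's inequality
  `CurvePlaces.degree_add_one_sub_genus_le_h0` (Hartshorne IV.1 Thm. 1.3) with `deg [P] = 1`
  (`residueDegree_pt`).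

The pole order is read off an ALGEBRAIC local equation `t` of the reduced divisor `[P]` whose
analytification has non-zero differential at `p` (`exists_chart_mfderiv_ne_zero`, GAGA §2 n°6
Cor. 2: `GAGALocalEquation`): `t^an = (z − c)·U₁` with `U₁(c) ≠ 0`
(`exists_eq_sub_mul_of_deriv_ne_zero`), while `tᴺ f` is regular at `P`
(`isRegularAt_pow_mul_of_mem_sections_smul_pointDivisor`: `ord_P` is a valuation, `ord_P [P] = 1`,
`ord_P t ≥ 1`) so that `(tᴺ f)^an` is holomorphic at `p` and `f^an = (z − c)^{−N}·(tᴺ f)^an·U₁^{−N}`.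
Values of regular functions at complex points only depend on the rational functions
(`evalOrZero_eq_pow_mul`, from `RatFn.section_ext`); a section vanishing at all complex points
off `P` is zero because a non-zero rational function is a unit on a non-empty open set, which
contains a closed = complex point (Nullstellensatz, Mathlib `nonempty_inter_closedPoints`).

## References

* [SerreGAGA1956] J.-P. Serre, Géométrie algébrique et géométrie analytique, Ann. Inst. Fourier 6
  (1956), §2 n°6, Prop. 3 Cor. 2.
* [Hartshorne1977] R. Hartshorne, Algebraic Geometry (1977), II.6 (divisors on curves), IV.1
  Thm. 1.3 (Riemann–Roch).
* [Stichtenoth2009] H. Stichtenoth, Algebraic Function Fields and Codes (2009), Prop. 1.4.9,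
  Thm. 1.4.17.
* [VoisinHodgeI2002] C. Voisin, Hodge Theory and Complex Algebraic Geometry I (2002), §2.2.1.
-/

noncomputable section

open scoped Manifold ContDiff Topology
open CategoryTheory AlgebraicGeometry TopologicalSpace Opposite Filter Set
open Literature.AlgebraicGeometry.Motives
open Literature.AlgebraicGeometry.Motives.RatFn
open Literature.AlgebraicGeometry.Motives.AlgPoints
open Literature.NumberTheory.Transcendental
open Literature.Geometry.Kaehler

universe u

namespace Literature.AlgebraicGeometry.HodgeTheory

/-! ### Values of regular functions at complex points -/

section Values

variable {X : SchemeOver ℂ} [IsIntegral X.left]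

/-- **A regular function vanishes at a complex point where its rational function is not a unit**
(`f(P) ≠ 0 ↔ P ∈ X_f ↔ f ∈ 𝒪_{X,P}^×`). [folklore] -/
theorem evalOrZero_eq_zero_of_not_isUnitAt {U : X.left.Opens} (σ : Γ(X.left, U))
    {P : ComplexPoints X} (hP : P.pt ∈ U)
    (h : ¬ IsUnitAt P.pt (ofSection (genericPoint_mem_of_mem hP) σ)) : evalOrZero U σ P = 0 := by
  rw [evalOrZero_of_mem _ hP]
  by_contra hne
  exact h ((isUnitAt_ofSection_iff hP σ).2 ((pt_mem_basicOpen_iff P hP σ).2 hne))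

/-- **A regular function does not vanish at a complex point where its rational function is a
unit.** [folklore] -/
theorem evalOrZero_ne_zero_of_isUnitAt {U : X.left.Opens} (σ : Γ(X.left, U))
    {P : ComplexPoints X} (hP : P.pt ∈ U)
    (h : IsUnitAt P.pt (ofSection (genericPoint_mem_of_mem hP) σ)) : evalOrZero U σ P ≠ 0 := by
  rw [evalOrZero_of_mem _ hP]
  exact (pt_mem_basicOpen_iff P hP σ).1 ((isUnitAt_ofSection_iff hP σ).1 h)

/-- **Values only depend on the rational functions: `f₃ = f₁ᴺ f₂` in `K(X)` gives
`f₃(P) = f₁(P)ᴺ f₂(P)`** for sections `σᵢ` of `fᵢ` over opens containing `P` (restrict to the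
intersection, where the sections themselves satisfy the identity, `RatFn.section_ext`).
[folklore] -/
theorem evalOrZero_eq_pow_mul {U₁ U₂ U₃ : X.left.Opens} (σ₁ : Γ(X.left, U₁)) (σ₂ : Γ(X.left, U₂))
    (σ₃ : Γ(X.left, U₃)) (N : ℕ) {P : ComplexPoints X} (h₁ : P.pt ∈ U₁) (h₂ : P.pt ∈ U₂)
    (h₃ : P.pt ∈ U₃)
    (h : ofSection (genericPoint_mem_of_mem h₃) σ₃ =
      ofSection (genericPoint_mem_of_mem h₁) σ₁ ^ N * ofSection (genericPoint_mem_of_mem h₂) σ₂) :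
    evalOrZero U₃ σ₃ P = evalOrZero U₁ σ₁ P ^ N * evalOrZero U₂ σ₂ P := by
  set W : X.left.Opens := U₁ ⊓ U₂ ⊓ U₃ with hWdef
  have hW : P.pt ∈ W := ⟨⟨h₁, h₂⟩, h₃⟩
  have hsec : X.left.presheaf.map (homOfLE (inf_le_right : W ≤ U₃)).op σ₃ =
      X.left.presheaf.map (homOfLE (inf_le_left.trans inf_le_left : W ≤ U₁)).op σ₁ ^ N *
        X.left.presheaf.map (homOfLE (inf_le_left.trans inf_le_right : W ≤ U₂)).op σ₂ := by
    refine section_ext fun hg ↦ ?_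
    simp only [map_mul, map_pow, ofSection_map]
    exact h
  have hpow : ∀ s : Γ(X.left, W), evalOrZero W (s ^ N) P = evalOrZero W s P ^ N := fun s ↦ by
    simp only [evalOrZero_of_mem _ hW, ← AlgPoints.evalRingHom_apply, map_pow]
  have hv := congrArg (fun σ ↦ evalOrZero W σ P) hsec
  simp only [evalOrZero_mul_apply] at hv
  rw [hpow, evalOrZero_map_homOfLE _ _ hW, evalOrZero_map_homOfLE _ _ hW,
    evalOrZero_map_homOfLE _ _ hW] at hv
  exact hv

/-- Values only depend on the rational function (`N = 0`, `σ₁ = 1` case of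
`evalOrZero_eq_pow_mul`). [folklore] -/
theorem evalOrZero_eq_of_ofSection_eq {U₂ U₃ : X.left.Opens} (σ₂ : Γ(X.left, U₂))
    (σ₃ : Γ(X.left, U₃)) {P : ComplexPoints X} (h₂ : P.pt ∈ U₂) (h₃ : P.pt ∈ U₃)
    (h : ofSection (genericPoint_mem_of_mem h₃) σ₃ = ofSection (genericPoint_mem_of_mem h₂) σ₂) :
    evalOrZero U₃ σ₃ P = evalOrZero U₂ σ₂ P := by
  have h' := evalOrZero_eq_pow_mul σ₂ σ₂ σ₃ 0 h₂ h₂ h₃ (by rw [pow_zero, one_mul]; exact h)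
  rwa [pow_zero, one_mul] at h'

end Values

/-! ### Complex points of a smooth proper curve -/

section Points

variable (C : SchemeOver ℂ) [IsIntegral C.left] [SmoothOfRelativeDimension 1 C.hom]

omit [IsIntegral C.left] in
/-- A smooth curve is locally of finite type over the base. [folklore] -/
theorem locallyOfFiniteType_of_smoothCurve : LocallyOfFiniteType C.hom :=
  haveI : Smooth C.hom := SmoothOfRelativeDimension.smooth 1 C.hom
  inferInstance

/-- The point of a complex point of the curve `C` is not the generic point (`dim C = 1`;
the point is closed, `ComplexPoints.isClosed_pt`). [folklore] -/
theorem pt_ne_genericPoint (P : ComplexPoints C) : P.pt ≠ genericPoint C.left := by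
  intro h
  have hcl := ComplexPoints.isClosed_pt P
  have hall : ∀ y : C.left, y = P.pt := fun y ↦ by
    have hy : y ∈ closure {genericPoint C.left} := by
      rw [(genericPoint_spec _).def]; trivial
    rw [← h, hcl.closure_eq] at hy
    exact hy
  have h1 := CurvePlaces.height_top_of_smoothCurve C
  have hne : ¬ IsMin (⊤ : ↥C.left) := by
    rw [← Order.height_eq_zero, h1]; decide
  obtain ⟨b, hb⟩ := not_isMin_iff.mp hne
  exact hb.ne ((hall b).trans (hall ⊤).symm)

omit [IsIntegral C.left] in
/-- Complex points of `C` with the same underlying point are equal (Nullstellensatz: complex points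
are the closed points). [folklore] -/
theorem pt_injective : Function.Injective fun P : ComplexPoints C ↦ P.pt := by
  haveI := locallyOfFiniteType_of_smoothCurve C
  intro P Q h
  apply (ComplexPoints.equivClosedPoints C).injective
  exact Subtype.ext (by
    rw [ComplexPoints.coe_equivClosedPoints_apply, ComplexPoints.coe_equivClosedPoints_apply]
    exact h)

omit [IsIntegral C.left] [SmoothOfRelativeDimension 1 C.hom] in
/-- **A complex point has residue degree one**: `[κ(P) : ℂ] = 1`. [folklore] -/
theorem residueDegree_pt (P : ComplexPoints C) : C.hom.residueDegree P.pt = 1 := by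
  have hw : P.left ≫ C.hom = 𝟙 _ := by
    rw [Over.w P]
    change Spec.map (CommRingCat.ofHom (algebraMap ℂ ℂ)) = 𝟙 _
    rw [Algebra.algebraMap_self, CommRingCat.ofHom_id, Spec.map_id]
  exact FieldPoint.residueDegree_eq_one_of_section C.hom hw

/-- **`deg (N · [P]) = N`** for a complex point `P` of the smooth complete curve `C`. [folklore] -/
theorem degree_smul_pointDivisor_pt [IsProper C.hom] (P : ComplexPoints C) (N : ℕ) :
    CartierDivisor.degree C (N • CurvePlaces.pointDivisor C (pt_ne_genericPoint C P)) = N := by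
  rw [CartierDivisor.degree_smul, CurvePlaces.degree_pointDivisor, residueDegree_pt]
  simp

end Points

/-! ### The sections of `𝒪(N·[P])`: regular off `P`, pole of order `≤ N` at `P`, `h⁰ ≥ N + 1 − g` -/

section Sections

open Literature.NumberTheory.DiophantineGeometry
  Literature.NumberTheory.DiophantineGeometry.AlgFunctionField

variable (C : SchemeOver ℂ) [IsIntegral C.left] [SmoothOfRelativeDimension 1 C.hom] [IsProper C.hom]
  (P : ComplexPoints C)

omit [IsProper C.hom] in
/-- **A section of `𝒪_C(N·[x])` is regular at every point other than `x`**: the local equation of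
`[x]` is a unit there. [cite: Hartshorne1977, II.6 Prop. 6.11 and IV.1] -/
theorem isRegularAt_of_mem_sections_smul_pointDivisor {x : C.left} (hx : x ≠ genericPoint C.left)
    {N : ℕ} {f : C.left.functionField}
    (hf : f ∈ (N • CurvePlaces.pointDivisor C hx).sections ℂ) {y : C.left} (hy : y ≠ x) :
    IsRegularAt y f := by
  set D₁ := CurvePlaces.pointDivisor C hx with hD₁
  obtain ⟨i, hi⟩ := D₁.covers y
  have hreg : IsRegularAt y (D₁.f i ^ N * f) := hf i y hi
  have hu : IsUnitAt y (D₁.f i) := (CurvePlaces.avoids_pointDivisor_iff C hx y).2 hy i hi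
  have h2 := (hu.pow N).inv.isRegularAt.mul hreg
  rwa [inv_mul_cancel_left₀ (pow_ne_zero _ (D₁.f_ne_zero i))] at h2

/-- **A section of `𝒪_C(N·[x])` has a pole of order `≤ N` at `x`**: for any `t ∈ 𝔪_x ⊆ 𝒪_{C,x}`,
`t ≠ 0`, the rational function `tᴺ f` is regular at `x` (`ord_x(f_i) = 1` for the local equation
of the reduced divisor `[x]`, `ord_x(t) ≥ 1`, `ord_x` is additive on the discrete valuation ring
`𝒪_{C,x}`). [cite: Hartshorne1977, II.6 (valuations) and IV.1] -/
theorem isRegularAt_pow_mul_of_mem_sections_smul_pointDivisor {x : C.left}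
    (hx : x ≠ genericPoint C.left) {N : ℕ} {f t : C.left.functionField}
    (hf : f ∈ (N • CurvePlaces.pointDivisor C hx).sections ℂ) (ht : IsRegularAt x t)
    (htu : ¬ IsUnitAt x t) (ht0 : t ≠ 0) : IsRegularAt x (t ^ N * f) := by
  by_cases hf0 : f = 0
  · rw [hf0, mul_zero]; exact isRegularAt_zero
  haveI := CurvePlaces.isDiscreteValuationRing_stalk C hx
  have hcoh : Order.coheight x = 1 := CurvePlaces.coheight_eq_one_of_isDiscreteValuationRing
  set D₁ := CurvePlaces.pointDivisor C hx with hD₁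
  obtain ⟨i, hi⟩ := D₁.covers x
  have hreg : IsRegularAt x (D₁.f i ^ N * f) := hf i x hi
  have hfi0 : D₁.f i ≠ 0 := D₁.f_ne_zero i
  have hord1 : Scheme.ord (D₁.f i) x = 1 := by
    rw [← D₁.ordAt_eq_ord hi]
    exact CurvePlaces.ordAt_pointDivisor_self hx
  have h1 : 0 ≤ Scheme.ord (D₁.f i ^ N * f) x :=
    (CurvePlaces.isRegularAt_iff_ord_nonneg (mul_ne_zero (pow_ne_zero _ hfi0) hf0)).1 hreg
  rw [Scheme.ord_mul (pow_ne_zero _ hfi0) hf0, Scheme.ord_pow' hfi0, hord1] at h1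
  have ht1 : 0 < Scheme.ord t x := ht.ord_pos htu ht0 hcoh
  rw [CurvePlaces.isRegularAt_iff_ord_nonneg (mul_ne_zero (pow_ne_zero _ ht0) hf0),
    Scheme.ord_mul (pow_ne_zero _ ht0) hf0, Scheme.ord_pow' ht0]
  nlinarith

/-- The space of sections `Γ(C, 𝒪(N·[P]))` is finite-dimensional (it is the Riemann–Roch space
`𝓛(N·v_P)` of the function field). [cite: Stichtenoth2009, Prop. 1.4.9] -/
theorem finiteDimensional_sections_smul_pointDivisor {x : C.left} (hx : x ≠ genericPoint C.left)
    (N : ℕ) : FiniteDimensional ℂ ((N • CurvePlaces.pointDivisor C hx).sections ℂ) := by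
  rw [CurvePlaces.sections_eq_riemannRochSpace]
  exact finiteDimensional_riemannRochSpace_of_isAlgFunctionField _

/-- **Riemann's inequality for `N·[P]`**: `dim Γ(C, 𝒪(N·[P])) ≥ N + 1 − g` for a complex point `P`
(`deg [P] = [κ(P) : ℂ] = 1`). [cite: Hartshorne1977, IV.1 Thm. 1.3 (Riemann–Roch)] -/
theorem le_finrank_sections_smul_pointDivisor (N : ℕ) :
    N + 1 ≤ Module.finrank ℂ ((N • CurvePlaces.pointDivisor C (pt_ne_genericPoint C P)).sections ℂ) +
      CurvePlaces.curveGenus C := by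
  have h := CurvePlaces.degree_add_one_sub_genus_le_h0 C
    (N • CurvePlaces.pointDivisor C (pt_ne_genericPoint C P))
  rw [degree_smul_pointDivisor_pt] at h
  unfold CartierDivisor.h0 at h
  omega

end Sections

/-! ### Chart readings of holomorphic functions: analyticity, the derivative, simple zeros -/

section Chart

variable {E : Type*} [NormedAddCommGroup E] [NormedSpace ℂ E]
  {M : Type*} [TopologicalSpace M] [ChartedSpace E M] [IsManifold 𝓘(ℂ, E) ω M]

/-- **A function holomorphic on an open neighbourhood of `p` is analytic in the chart at `p`**
(read through a `ℂ`-linear coordinate `ℓ : E ≃ ℂ`). [cite: VoisinHodgeI2002, §2.2.1] -/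
theorem analyticAt_comp_extChartAt_symm {g : M → ℂ} {O : Set M} (hO : IsOpen O) {p : M}
    (hp : p ∈ O) (hg : MDifferentiableOn 𝓘(ℂ, E) 𝓘(ℂ, ℂ) g O) (ℓ : E ≃L[ℂ] ℂ) :
    AnalyticAt ℂ (fun z ↦ g ((extChartAt 𝓘(ℝ, E) p).symm (ℓ.symm z)))
      (ℓ (extChartAt 𝓘(ℝ, E) p p)) := by
  set ch := extChartAt 𝓘(ℝ, E) p with hch
  set Z : Set ℂ := ℓ.symm ⁻¹' (ch.target ∩ ch.symm ⁻¹' O) with hZ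
  have hZo : IsOpen Z :=
    ((continuousOn_extChartAt_symm p).isOpen_inter_preimage (isOpen_extChartAt_target p)
      hO).preimage ℓ.symm.continuous
  have hcZ : ℓ (ch p) ∈ Z := by
    show ℓ.symm (ℓ (ch p)) ∈ ch.target ∩ ch.symm ⁻¹' O
    rw [ℓ.symm_apply_apply]
    refine ⟨mem_extChartAt_target p, ?_⟩
    rw [mem_preimage, hch, extChartAt_to_inv]
    exact hp
  have hd : DifferentiableOn ℂ (fun z ↦ g (ch.symm (ℓ.symm z))) Z := by
    intro z hz
    have hy : ℓ.symm z ∈ ch.target := hz.1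
    have hm : ch.symm (ℓ.symm z) ∈ O := hz.2
    have hms : ch.symm (ℓ.symm z) ∈ ch.source := ch.map_target hy
    have hmd : MDifferentiableAt 𝓘(ℂ, E) 𝓘(ℂ, ℂ) g (ch.symm (ℓ.symm z)) :=
      (hg _ hm).mdifferentiableAt (hO.mem_nhds hm)
    have h1 := differentiableAt_comp_extChartAt_symm hms hmd
    rw [ch.right_inv hy] at h1
    exact (h1.comp z ℓ.symm.differentiableAt).differentiableWithinAt
  exact hd.analyticAt (hZo.mem_nhds hcZ)

/-- **A non-zero differential gives a non-zero derivative in the chart**: on a complex CURVE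
(`dim E = 1`), if `dg(p) ≠ 0` then the chart reading `z ↦ g(chart⁻¹(ℓ⁻¹ z))` has non-zero
derivative at `ℓ (chart p)`. [cite: VoisinHodgeI2002, §2.2.1] -/
theorem deriv_comp_extChartAt_symm_ne_zero {g : M → ℂ} {p : M}
    (hg : MDifferentiableAt 𝓘(ℂ, E) 𝓘(ℂ, ℂ) g p) (hd : mfderiv 𝓘(ℂ, E) 𝓘(ℂ, ℂ) g p ≠ 0)
    (ℓ : E ≃L[ℂ] ℂ) :
    deriv (fun z ↦ g ((extChartAt 𝓘(ℝ, E) p).symm (ℓ.symm z))) (ℓ (extChartAt 𝓘(ℝ, E) p p)) ≠ 0 := by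
  set ch := extChartAt 𝓘(ℝ, E) p with hch
  have hmf := hg.mfderiv
  have hw : writtenInExtChartAt 𝓘(ℂ, E) 𝓘(ℂ, ℂ) p g = g ∘ ch.symm := by
    funext y
    simp only [writtenInExtChartAt, extChartAt_model_space_eq_id, PartialEquiv.refl_coe,
      Function.comp_apply, id_eq]
    rfl
  rw [hw, ModelWithCorners.Boundaryless.range_eq_univ, fderivWithin_univ] at hmf
  have hF : fderiv ℂ (g ∘ ch.symm) (ch p) ≠ 0 := by
    intro h0
    apply hd
    rw [hmf]
    exact h0
  have hv : fderiv ℂ (g ∘ ch.symm) (ch p) (ℓ.symm 1) ≠ 0 := by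
    intro h0
    apply hF
    ext v
    rw [eq_smul_symm_one ℓ v, _root_.map_smul, h0, smul_zero]
    rfl
  have hdiff : DifferentiableAt ℂ (g ∘ ch.symm) (ch p) :=
    differentiableAt_comp_extChartAt_symm (mem_extChartAt_source p) hg
  have h2 : HasFDerivAt (g ∘ ch.symm) (fderiv ℂ (g ∘ ch.symm) (ch p)) (ℓ.symm (ℓ (ch p))) := by
    rw [ℓ.symm_apply_apply]; exact hdiff.hasFDerivAt
  have hc : HasFDerivAt (fun z ↦ g (ch.symm (ℓ.symm z)))
      ((fderiv ℂ (g ∘ ch.symm) (ch p)).comp (ℓ.symm : ℂ →L[ℂ] E)) (ℓ (ch p)) :=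
    h2.comp _ ℓ.symm.hasFDerivAt
  rw [hc.hasDerivAt.deriv]
  exact hv

/-- **A simple zero factors**: if `U` is analytic at `c` with `U(c) = 0`, `U′(c) ≠ 0`, then
`U(z) = (z − c) U₁(z)` near `c` with `U₁` analytic and `U₁(c) ≠ 0`. [folklore] -/
theorem exists_eq_sub_mul_of_deriv_ne_zero {U : ℂ → ℂ} {c : ℂ} (hU : AnalyticAt ℂ U c)
    (h0 : U c = 0) (hd : deriv U c ≠ 0) :
    ∃ U₁ : ℂ → ℂ, AnalyticAt ℂ U₁ c ∧ U₁ c ≠ 0 ∧ ∀ᶠ z in 𝓝 c, U z = (z - c) * U₁ z := by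
  obtain ⟨U₁, h1, h2, h3⟩ := (hU.analyticOrderAt_eq_natCast (n := 1)).1
    (hU.analyticOrderAt_eq_one_of_zero_deriv_ne_zero h0 hd)
  exact ⟨U₁, h1, h2, h3.mono fun z hz ↦ by rw [hz, pow_one, smul_eq_mul]⟩

end Chart

/-! ### The pole spaces `L(N·[P])^an` on an analytification of the curve -/

section PoleSpace

variable {C : SchemeOver ℂ} [IsIntegral C.left] [SmoothOfRelativeDimension 1 C.hom] [IsProper C.hom]

omit [SmoothOfRelativeDimension 1 C.hom] [IsProper C.hom] in
/-- The rational function of the scalar section `c ∈ Γ(U, 𝒪_C)` is the constant `c ∈ K(C)`.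
[folklore] -/
theorem ofSection_scalarRingHom {U : C.left.Opens} (hU : genericPoint C.left ∈ U) (c : ℂ) :
    ofSection hU (SchemeOver.scalarRingHom C U c) = algebraMap ℂ C.left.functionField c := by
  have h1 : SchemeOver.scalarRingHom C U c = C.left.presheaf.map (homOfLE (le_top : U ≤ ⊤)).op
      (C.hom.appTop ((Scheme.ΓSpecIso (.of ℂ)).inv c)) := rfl
  rw [h1, ofSection_map]
  exact (RatFn.algebraMap_stalk_apply (K := ℂ) (genericPoint C.left) c).symm

omit [SmoothOfRelativeDimension 1 C.hom] [IsProper C.hom] in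
/-- `sectionOf` is additive. [folklore] -/
theorem sectionOf_add {U : C.left.Opens} (hU : genericPoint C.left ∈ U) (f g : C.left.functionField)
    (hf : ∀ y ∈ U, IsRegularAt y f) (hg : ∀ y ∈ U, IsRegularAt y g)
    (hfg : ∀ y ∈ U, IsRegularAt y (f + g)) :
    sectionOf hU (f + g) hfg = sectionOf hU f hf + sectionOf hU g hg :=
  section_ext fun h ↦ by
    have e0 : ofSection h (sectionOf hU (f + g) hfg) = f + g := ofSection_sectionOf _ _ _
    have e1 : ofSection h (sectionOf hU f hf) = f := ofSection_sectionOf _ _ _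
    have e2 : ofSection h (sectionOf hU g hg) = g := ofSection_sectionOf _ _ _
    have e3 : ofSection h (sectionOf hU f hf + sectionOf hU g hg) =
        ofSection h (sectionOf hU f hf) + ofSection h (sectionOf hU g hg) :=
      map_add (C.left.presheaf.germ U (genericPoint C.left) h).hom _ _
    rw [e0, e3, e1, e2]

omit [SmoothOfRelativeDimension 1 C.hom] [IsProper C.hom] in
/-- `sectionOf` of a scalar multiple. [folklore] -/
theorem sectionOf_smul {U : C.left.Opens} (hU : genericPoint C.left ∈ U) (c : ℂ)
    (f : C.left.functionField) (hf : ∀ y ∈ U, IsRegularAt y f)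
    (hcf : ∀ y ∈ U, IsRegularAt y (c • f)) :
    sectionOf hU (c • f) hcf = SchemeOver.scalarRingHom C U c * sectionOf hU f hf :=
  section_ext fun h ↦ by
    have e0 : ofSection h (sectionOf hU (c • f) hcf) = c • f := ofSection_sectionOf _ _ _
    have e1 : ofSection h (sectionOf hU f hf) = f := ofSection_sectionOf _ _ _
    have e3 : ofSection h (SchemeOver.scalarRingHom C U c * sectionOf hU f hf) =
        ofSection h (SchemeOver.scalarRingHom C U c) * ofSection h (sectionOf hU f hf) :=
      map_mul (C.left.presheaf.germ U (genericPoint C.left) h).hom _ _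
    rw [e0, e3, e1, ofSection_scalarRingHom, Algebra.smul_def]

/-- **The pole spaces of a complex point on an analytification of a smooth projective complex
curve.** Let `C/ℂ` be a smooth projective curve with analytification `φ : M → C(ℂ)` (charts in
`E`, `dim E = 1`, `ℓ : E ≃ ℂ`), `p ∈ M`, `P = φ p`, `N : ℕ`. The analytifications
`m ↦ f(φ m)` of the sections `f ∈ Γ(C, 𝒪(N·[P])) ⊆ K(C)` (`f` regular off `P`, read through
`sectionOf` on `C ∖ {P}`) form a space `V_N` of functions on `M` with: each is holomorphic off `p`
(regular functions are holomorphic, GAGA §2 n°6); each has a pole of order `≤ N` at `p` in the chart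
at `p` — `h = (z − c)^{−N} G` with `G` holomorphic near `c = ℓ(chart p)` (a local equation `t` of
`[P]` has HOLOMORPHIC DIFFERENTIAL `≠ 0` at `p`, `exists_chart_mfderiv_ne_zero` = GAGA §2 n°6 Cor. 2,
so `t^an = (z − c)·(unit)`, and `tᴺ f` is regular at `P`); each is determined by its values off `p`
(a non-zero rational function is a unit on a non-empty open set, which has a complex point —
Nullstellensatz); and `dim V_N = h⁰(N·[P]) ≥ N + 1 − g` (Riemann's inequality,
`CurvePlaces.degree_add_one_sub_genus_le_h0`, `deg [P] = 1`). These are the hypotheses `hV` of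
`Geometry/Kaehler/CurveOneFormsBound.finrank_le_of_forall_exists_poleSpace`.
[cite: SerreGAGA1956, §2 n°6 and Cor. 2] [cite: Hartshorne1977, IV.1 Thm. 1.3 (Riemann–Roch)] -/
theorem exists_poleSpace (hC : IsSmoothProjective 1 C)
    {E : Type} [NormedAddCommGroup E] [NormedSpace ℂ E] [FiniteDimensional ℂ E]
    {M : Type} [TopologicalSpace M] [ChartedSpace E M] [IsManifold 𝓘(ℂ, E) ω M]
    {φ : M → ComplexPoints C} (hφ : IsAnalytification E C 1 φ) (ℓ : E ≃L[ℂ] ℂ) (p : M) (N : ℕ) :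
    ∃ V : Submodule ℂ (M → ℂ),
      (∀ h ∈ V, ∀ m, m ≠ p → MDifferentiableAt 𝓘(ℂ, E) 𝓘(ℂ, ℂ) h m) ∧
      (∀ h ∈ V, ∃ G : ℂ → ℂ, AnalyticAt ℂ G (ℓ (extChartAt 𝓘(ℝ, E) p p)) ∧
        ∀ᶠ z in 𝓝[≠] (ℓ (extChartAt 𝓘(ℝ, E) p p)),
          h ((extChartAt 𝓘(ℝ, E) p).symm (ℓ.symm z)) =
            (z - ℓ (extChartAt 𝓘(ℝ, E) p p)) ^ (-(N : ℤ)) * G z) ∧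
      (∀ h ∈ V, (∀ m, m ≠ p → h m = 0) → h = 0) ∧
      FiniteDimensional ℂ V ∧ N + 1 ≤ Module.finrank ℂ V + CurvePlaces.curveGenus C := by
  classical
  haveI := locallyOfFiniteType_of_smoothCurve C
  set ch := extChartAt 𝓘(ℝ, E) p with hch
  set c := ℓ (ch p) with hc
  set P := φ p with hPdef
  have hx : P.pt ≠ genericPoint C.left := pt_ne_genericPoint C P
  -- points of `M` other than `p` lie over points of `C` other than `P.pt`
  have hne : ∀ m, m ≠ p → (φ m).pt ≠ P.pt := fun m hm h ↦
    hm (hφ.isHomeomorph.injective (pt_injective C h))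
  -- the space of sections of `𝒪(N·[P])`
  set L : Submodule ℂ C.left.functionField :=
    (N • CurvePlaces.pointDivisor C hx).sections ℂ with hL
  haveI : FiniteDimensional ℂ L := finiteDimensional_sections_smul_pointDivisor C hx N
  -- the open complement of `P.pt`
  set W : C.left.Opens := CurvePlaces.complSingleton C hx with hW
  have hWgen : genericPoint C.left ∈ W := fun h ↦ hx h.symm
  have hreg : ∀ f : L, ∀ y ∈ W, IsRegularAt y (f : C.left.functionField) := fun f y hy ↦
    isRegularAt_of_mem_sections_smul_pointDivisor C hx f.2
      ((CurvePlaces.mem_complSingleton_iff C hx y).1 hy)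
  -- the analytification map on sections
  let an : L →ₗ[ℂ] (M → ℂ) :=
    { toFun := fun f m ↦ evalOrZero W (sectionOf hWgen (f : C.left.functionField) (hreg f)) (φ m)
      map_add' := fun f g ↦ by
        funext m
        rw [Pi.add_apply]
        have h := sectionOf_add hWgen (f : C.left.functionField) g (hreg f) (hreg g) (hreg (f + g))
        change evalOrZero W (sectionOf hWgen ((f : C.left.functionField) + g) (hreg (f + g))) (φ m) = _
        rw [h, GAGADimension.evalOrZero_add, Pi.add_apply]
      map_smul' := fun a f ↦ by
        funext m
        rw [Pi.smul_apply, RingHom.id_apply, smul_eq_mul]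
        change evalOrZero W (sectionOf hWgen (a • (f : C.left.functionField)) (hreg (a • f))) (φ m) = _
        rw [sectionOf_smul hWgen a (f : C.left.functionField) (hreg f) (hreg (a • f)),
          evalOrZero_mul_apply]
        by_cases hm : (φ m).pt ∈ W
        · rw [GAGADimension.evalOrZero_scalarRingHom W a hm]
        · rw [evalOrZero_of_not_mem _ hm, evalOrZero_of_not_mem _ hm, mul_zero, mul_zero] }
  have han : ∀ (f : L) (m : M),
      an f m = evalOrZero W (sectionOf hWgen (f : C.left.functionField) (hreg f)) (φ m) :=
    fun f m ↦ rfl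
  -- injectivity: a section vanishing at the complex points off `P` is zero
  have hinj : ∀ f : L, (∀ m, m ≠ p → an f m = 0) → f = 0 := by
    intro f hf0
    by_contra hfne
    have hfne' : (f : C.left.functionField) ≠ 0 := fun h ↦ hfne (Subtype.ext h)
    set S : Set C.left := {y | IsUnitAt y (f : C.left.functionField)} ∩ (W : Set C.left) with hS
    have hSo : IsOpen S := (isOpen_setOf_isUnitAt _).inter W.isOpen
    have hSne : S.Nonempty := ⟨genericPoint C.left, isUnitAt_genericPoint hfne', hWgen⟩
    haveI : JacobsonSpace C.left := LocallyOfFiniteType.jacobsonSpace C.hom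
    obtain ⟨y, hy, hyc⟩ := nonempty_inter_closedPoints hSne hSo.isLocallyClosed
    set Q := (ComplexPoints.equivClosedPoints C).symm ⟨y, hyc⟩ with hQ
    have hQpt : Q.pt = y := by
      have h := ComplexPoints.coe_equivClosedPoints_apply C Q
      rw [hQ, Equiv.apply_symm_apply] at h
      exact h.symm
    set m := hφ.homeomorph.symm Q with hm
    have hφm : φ m = Q := by
      rw [hm]
      exact hφ.homeomorph.apply_symm_apply Q
    have hmp : m ≠ p := by
      intro hmp
      have h2 : Q.pt = P.pt := by rw [← hφm, hmp]
      rw [hQpt] at h2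
      exact ((CurvePlaces.mem_complSingleton_iff C hx y).1 hy.2) h2
    have hval := hf0 m hmp
    rw [han, hφm] at hval
    have hQW : Q.pt ∈ W := by rw [hQpt]; exact hy.2
    refine evalOrZero_ne_zero_of_isUnitAt _ hQW ?_ hval
    rw [ofSection_sectionOf, hQpt]
    exact hy.1
  have hinj' : Function.Injective an := by
    refine (injective_iff_map_eq_zero an).2 fun f hf ↦ hinj f fun m _ ↦ ?_
    rw [hf, Pi.zero_apply]
  refine ⟨LinearMap.range an, ?_, ?_, ?_, inferInstance, ?_⟩
  · -- holomorphy off `p`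
    rintro _ ⟨f, rfl⟩ m hm
    have hmem : m ∈ φ ⁻¹' {Q : ComplexPoints C | Q.pt ∈ W} :=
      (CurvePlaces.mem_complSingleton_iff C hx _).2 (hne m hm)
    exact (IsAnalytification.mdifferentiableOn_evalOrZero_opens_holds hφ W _).mdifferentiableAt
      ((hφ.isOpen_preimage W).mem_nhds hmem)
  · -- the pole of order `≤ N` at `p`
    rintro _ ⟨f, rfl⟩
    -- an algebraic local equation of `[P]` with non-zero holomorphic differential at `p`
    have hcoh : Order.coheight P.pt = 1 := by
      haveI := CurvePlaces.isDiscreteValuationRing_stalk C hx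
      exact CurvePlaces.coheight_eq_one_of_isDiscreteValuationRing
    have hgenpt : IsGenericPoint P.pt ({P.pt} : Set C.left) := (ComplexPoints.isClosed_pt P).closure_eq
    obtain ⟨cW, hxW, hdc⟩ := exists_chart_mfderiv_ne_zero hC hφ (ComplexPoints.isClosed_pt P) hgenpt hcoh
    set u : M → ℂ := fun m ↦ evalOrZero cW.W cW.j (φ m) with hu
    have hu_hol : MDifferentiableOn 𝓘(ℂ, E) 𝓘(ℂ, ℂ) u (φ ⁻¹' {Q : ComplexPoints C | Q.pt ∈ cW.W}) :=
      IsAnalytification.mdifferentiableOn_evalOrZero_opens_holds hφ cW.W cW.j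
    have hpW : p ∈ φ ⁻¹' {Q : ComplexPoints C | Q.pt ∈ cW.W} := hxW
    have hup : u p = 0 := (evalOrZero_chart_eq_zero_iff cW hxW).2 (fun h ↦ h rfl)
    have hdu : mfderiv 𝓘(ℂ, E) 𝓘(ℂ, ℂ) u p ≠ 0 := hdc p hxW rfl
    -- the rational local equation `t`, regular and not a unit at `P.pt`
    set t : C.left.functionField := ofSection (genericPoint_mem_of_mem hxW) cW.j with ht
    have ht_fn : t = cW.fn := cW.ofSection_j _
    have ht_reg : IsRegularAt P.pt t := isRegularAt_ofSection hxW cW.j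
    have htu : ¬ IsUnitAt P.pt t := by
      rw [ht_fn, cW.isUnitAt_iff hxW]
      exact fun h ↦ h rfl
    have ht0 : t ≠ 0 := by rw [ht_fn]; exact cW.ne_zero
    -- `s = tᴺ f` is regular at `P.pt`, hence on an open `W₂ ∋ P.pt`
    set s : C.left.functionField := t ^ N * (f : C.left.functionField) with hs
    have hs_x : IsRegularAt P.pt s :=
      isRegularAt_pow_mul_of_mem_sections_smul_pointDivisor C hx f.2 ht_reg htu ht0
    set W₂ : C.left.Opens := ⟨{y | IsRegularAt y s}, isOpen_setOf_isRegularAt s⟩ with hW₂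
    have hxW₂ : P.pt ∈ W₂ := hs_x
    set σ₂ := sectionOf (genericPoint_mem_of_mem hxW₂) s (fun y hy ↦ hy) with hσ₂
    set Sf : M → ℂ := fun m ↦ evalOrZero W₂ σ₂ (φ m) with hSf
    have hS_hol : MDifferentiableOn 𝓘(ℂ, E) 𝓘(ℂ, ℂ) Sf (φ ⁻¹' {Q : ComplexPoints C | Q.pt ∈ W₂}) :=
      IsAnalytification.mdifferentiableOn_evalOrZero_opens_holds hφ W₂ σ₂
    have hpW₂ : p ∈ φ ⁻¹' {Q : ComplexPoints C | Q.pt ∈ W₂} := hxW₂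
    -- the product identity `s(φ m) = t(φ m)ᴺ · f(φ m)` off `p`
    have hprod : ∀ m, m ≠ p → (φ m).pt ∈ cW.W → (φ m).pt ∈ W₂ → Sf m = u m ^ N * an f m := by
      intro m hm h₁ h₃
      have h₂ : (φ m).pt ∈ W := (CurvePlaces.mem_complSingleton_iff C hx _).2 (hne m hm)
      rw [han]
      refine evalOrZero_eq_pow_mul cW.j _ σ₂ N h₁ h₂ h₃ ?_
      rw [ofSection_sectionOf, ofSection_sectionOf]
    -- chart readings
    have hUc : AnalyticAt ℂ (fun z ↦ u (ch.symm (ℓ.symm z))) c :=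
      analyticAt_comp_extChartAt_symm (hφ.isOpen_preimage cW.W) hpW hu_hol ℓ
    have hSc : AnalyticAt ℂ (fun z ↦ Sf (ch.symm (ℓ.symm z))) c :=
      analyticAt_comp_extChartAt_symm (hφ.isOpen_preimage W₂) hpW₂ hS_hol ℓ
    have hUc0 : u (ch.symm (ℓ.symm c)) = 0 := by
      rw [hc, ℓ.symm_apply_apply, hch, extChartAt_to_inv]
      exact hup
    have hUc' : deriv (fun z ↦ u (ch.symm (ℓ.symm z))) c ≠ 0 :=
      deriv_comp_extChartAt_symm_ne_zero
        (hu_hol.mdifferentiableAt ((hφ.isOpen_preimage cW.W).mem_nhds hpW)) hdu ℓ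
    obtain ⟨U₁, hU₁, hU₁0, hUfac⟩ := exists_eq_sub_mul_of_deriv_ne_zero hUc hUc0 hUc'
    refine ⟨fun z ↦ Sf (ch.symm (ℓ.symm z)) * (U₁ z ^ N)⁻¹,
      hSc.mul ((hU₁.pow N).inv (pow_ne_zero _ hU₁0)), ?_⟩
    -- neighbourhoods
    have hcont : ContinuousAt (fun z ↦ ch.symm (ℓ.symm z)) c := by
      refine ContinuousAt.comp ?_ ℓ.symm.continuous.continuousAt
      rw [hc, ℓ.symm_apply_apply]
      exact continuousAt_extChartAt_symm p
    have hval : (fun z ↦ ch.symm (ℓ.symm z)) c = p := by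
      show ch.symm (ℓ.symm c) = p
      rw [hc, ℓ.symm_apply_apply, hch, extChartAt_to_inv]
    have hO : ∀ᶠ z in 𝓝 c, ch.symm (ℓ.symm z) ∈
        φ ⁻¹' {Q : ComplexPoints C | Q.pt ∈ cW.W} ∩ φ ⁻¹' {Q : ComplexPoints C | Q.pt ∈ W₂} := by
      refine hcont.eventually (p := fun m ↦ m ∈ φ ⁻¹' {Q : ComplexPoints C | Q.pt ∈ cW.W} ∩
        φ ⁻¹' {Q : ComplexPoints C | Q.pt ∈ W₂}) ?_
      rw [hval]
      exact ((hφ.isOpen_preimage cW.W).inter (hφ.isOpen_preimage W₂)).mem_nhds ⟨hpW, hpW₂⟩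
    have htarget : ∀ᶠ z in 𝓝 c, ℓ.symm z ∈ ch.target := by
      refine ℓ.symm.continuous.continuousAt.eventually (p := fun y ↦ y ∈ ch.target) ?_
      rw [hc, ℓ.symm_apply_apply]
      exact (isOpen_extChartAt_target p).mem_nhds (mem_extChartAt_target p)
    have hU₁ne : ∀ᶠ z in 𝓝 c, U₁ z ≠ 0 := hU₁.continuousAt.eventually_ne hU₁0
    rw [eventually_nhdsWithin_iff]
    filter_upwards [hO, htarget, hU₁ne, hUfac] with z hz hzt hz1 hzU hzc
    have hmp : ch.symm (ℓ.symm z) ≠ p := by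
      intro h0
      apply hzc
      have h2 : ch (ch.symm (ℓ.symm z)) = ch p := by rw [h0]
      rw [ch.right_inv hzt] at h2
      have h3 := congrArg ℓ h2
      rwa [ℓ.apply_symm_apply] at h3
    have hSz := hprod _ hmp hz.1 hz.2
    have hUz0 : u (ch.symm (ℓ.symm z)) ≠ 0 := by
      rw [hzU]; exact mul_ne_zero (sub_ne_zero.2 hzc) hz1
    have heq : an f (ch.symm (ℓ.symm z)) =
        Sf (ch.symm (ℓ.symm z)) * (u (ch.symm (ℓ.symm z)) ^ N)⁻¹ := by
      rw [hSz, mul_comm (u _ ^ N), mul_assoc, mul_inv_cancel₀ (pow_ne_zero _ hUz0), mul_one]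
    rw [heq, hzU, mul_pow, mul_inv, zpow_neg, zpow_natCast]
    ring
  · -- determined by the values off `p`
    rintro _ ⟨f, rfl⟩ hf0
    rw [hinj f hf0, map_zero]
  · -- dimension
    rw [LinearMap.finrank_range_of_inj hinj']
    exact le_finrank_sections_smul_pointDivisor C P N

end PoleSpace

end Literature.AlgebraicGeometry.HodgeTheory

end
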